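import Summits.NavierStokesRegularity.NavierStokesRegularity.Theses.DssFarFieldSlaving
import HarnessLib.Audit

/-!
# Birth skeleton (BC3) of the crux `DssFarFieldSlaving.DssTruncationBridge`

(crux item `stmt-NavierStokesRegularity-14477`, rank 2, route `route-NavierStokesRegularity-DssFarFieldSlaving`
(conditional negative-side bridge); tree path `Cruxes/DssTruncationBridge/Lines/birth.lean`; registrar
`planner-skel-stmt-NavierStokesRegularity-14477-0`, 2026-08-17. The route predates the Lean birth certificate;
this file supplies BC3 retroactively. At registration time `ledger crux ls stmt-NavierStokesRegularity-14477`
showed NO workfiles: no `Disproof.lean`, no `Lines/`, no ideas, no dead lines, no `Negative/` lemmas.)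

THE CRUX (by name, never restated): `B = DssTruncationBridge` — if Tsai's Type-I (rotated) `λ`-DSS Liouville
wall fails, `¬ (∀ c, TypeIDSSLiouville c ∧ ∀ R, RotatedTypeIDSSLiouville c R)` (verbatim the route's crux #5
`BlowupTypeIDssProfile` = shared item stmt-0155), then for some `ν > 0`, `T > 0` there is a Leray–Hopf CLASSICAL
solution `(u, p)` from a rapidly decaying datum with FINITE MAXIMAL lifespan `T`
(`IsMaximalSmoothSolution ν 0 u p T ∧ IsLerayHopfOn T ν 0 (u 0) u ∧ HasRapidSpatialDecay (u 0)` = X5a of route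
Blowup). Refuter record (crux-attack 2026-08-16): SURVIVES; `B ⇔ (Tsai's wall) ∨ X5a`, strictly weaker than X5a,
not a restatement of the summit.

THE CUT — along the seam of the route's own mechanism, in BACKWARD SIMILARITY VARIABLES about the prospective
singular point `(x₀, T) = (0, T)` (`lerayOrbit`, accepted in `Literature.Analysis.FluidPDE.HyperbolicDSSOrbit`:
`U(s, y) = e^{-s/2} u(−e^{−s}, e^{−s/2} y)`; a rotated `c`-DSS field has a `2 log c`-periodic orbit modulo `R`,
`IsRotatedDSS.lerayOrbit_add_period`):

* `stub_smoothProfile_of_notLiouville` [M/L, TRUE — provable; KNSS 2009 §4 regularity]: the negated wall yields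
  a Type-I rotated-DSS ancient PROFILE in the sense of the route's requested notion `IsTypeIDSSProfile c R u`
  (`1 < c`, ancient mild with `ν = 1`, measurable slices, `IsRotatedDSS c R u`, Type-I bound, not a.e. trivial,
  AND jointly smooth on `t < 0`). Content: `push_neg`; the plain-DSS disjunct is the case `R = 1`
  (`rotatedTypeIDSSLiouville_refl_iff`); then pass to the smooth representative — on every window `t < −δ` the
  Type-I bound makes `u` a BOUNDED ancient mild solution, hence smooth (KNSS 2009 §2–4; in-tree
  `KNSS2009_mild_regularity_holds`, `exists_stronglyMeasurable_modification`), and the continuous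
  representative (extended by `0` for `t ≥ 0`) is again rotated DSS, Type I (everywhere, by continuity),
  ancient mild and nontrivial. This is exactly the hypothesis of crux #4 `GaussianFloquetTheory`
  (`HyperbolicDSSOrbit` module docstring: "automatic after passing to the continuous representative").
* `stub_orbitShadowing_of_profile` [XL, OPEN — the analytic heart: FAR-FIELD SLAVING]: for a Type-I DSS profile
  `u` there are `T > 0` and a classical solution `(v, p)` of NS (`ν = 1`) on `[0, T) × ℝ³`, Leray–Hopf on
  `[0, T)` from its own rapidly decaying datum `v 0`, whose similarity orbit about `(0, T)` SHADOWS the profile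
  orbit in sup norm at all late similarity times, up to an error below the profile's amplitude:
  `∃ s₀ ε, (∃ s y, ε < ‖U(s, y)‖) ∧ ∀ s ≥ s₀, ∀ y, ‖V(s, y) − U(s, y)‖ ≤ ε`, `V = lerayOrbit (v(· + T))`.
  The route's internal decomposition of this stub: crux #4 `GaussianFloquetTheory` (COMPACT linearised
  monodromy on `L²_σ(e^{−|y|²/4})` ⇒ discrete Floquet spectrum ⇒ the centre-unstable space is
  FINITE-dimensional, so the strong-stable set of the orbit has finite codimension even WITHOUT the
  hyperbolicity (H2) of crux #3 — this is why the strong form B is a bet and not a costume of #3), (B2) the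
  mixed-topology `L²(γ) ∩ L^∞_{1+|y|}` far-field/core decoupling (outward drift `½ y·∇`, far-field pressure
  `≲ C₀²/L²`), (B3) Lyapunov–Perron for the periodic orbit, (B4) Schwartz realisation of the tuned datum
  (Bogovskiĭ-corrected truncation `χ_R u(·, −T)` + finitely many compactly supported solenoidal bumps).
  Why it might fail: the route file's own line — unstable spectrum accumulating at the unit circle if the
  sup-norm half of the bootstrap creates essential spectrum; `P_σ`/Biot–Savart undefined on `L²(γ)` verbatim.
  Sources: JiaSverak2015 (arXiv:1306.2136) §1–2 (forward twin), BradshawTsai2017CPDE §5 OP 5.1,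
  AlbrittonBarker2019 (arXiv:1811.00502) Thm 1.1 / Rem 4.3 (local, forced transfer only), Henry1981 Ch. 7–8,
  GallayWayne2005, MerleZaag1997 / arXiv:1605.07337 (prescribed-profile template).
* `stub_singularPoint_of_orbitShadowing` [S/M, TRUE — provable now; scaling + twisted periodicity]: if `u` is
  rotated `c`-DSS (`1 < c`), `0 < T`, and the orbit of ANY field `v` about `(0, T)` shadows `U` in sup norm for
  `s ≥ s₀` with an error `ε` exceeded by `‖U(s₁, y₁)‖` somewhere, then `v` is unbounded at nonnegative times on
  every backward parabolic cylinder `Q_r(T, 0)`. (Iterate `U(s + 2 log c, R⁻¹ y) = R⁻¹ U(s, y)`: the amplitude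
  `a = ‖U(s₁, y₁)‖ > ε` recurs at `(s₁ + 2k log c, R^{-k} y₁)`, fixed `‖y‖`; there `‖V‖ ≥ a − ε`, i.e.
  `‖v(T − e^{−s}, e^{−s/2} y)‖ ≥ (a − ε) e^{s/2} → ∞`, and the physical points enter `Q_r(T, 0) ∩ {t ≥ 0}`.)

The continuation lemma `not_hasSmoothExtensionPast_of_singularPoint` (velocity unbounded at nonnegative times
on `Q_1(T, x₀)` ⇒ no classical extension past `T`; the velocity twin of the accepted
`VorticityBlowsUpOnAt.not_hasSmoothExtensionPast`, same compactness argument) is PROVED here — it is assembly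
glue, not a stub.

`DssTruncationBridge_of : Theses.DssFarFieldSlaving.DssTruncationBridge` is the ONLY theorem of this file
concluding the crux (BY NAME; the three stubs used by name; placeholders only inside the three `stub_*`):
profile from stub 0; `(T, v, p)` and the shadowing data from the heart; singular point `(T, 0)` from stub 1;
maximality from the proved continuation lemma; `ν = 1`. Its CLOSED twin `DssTruncationBridge_of_hyps`
(stub statements as hypotheses, no placeholder anywhere, conclusion the crux by name) is the registrar's
evidence file `bc/DssTruncationBridge_birth_closed.lean`.

BC3 PROBES (registrar folder `bc/probe_*.lean`): for each stub `S`, `S → DssTruncationBridge`,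
`S → NavierStokesRegularity` and `S → ¬NavierStokesRegularity` by `first | exact? | simpa | aesop` (+ unfold
variants) must all FAIL (results quoted in `Lines/birth.md`). Stubs 0 and 1 are TRUE statements, so `S → crux`
is the crux itself; the heart lacks the singular-point and continuation arguments and says nothing about
Clay (A). Disproof used: none exists for this crux. Junk audit: `lerayOrbit (v(· + T))` at `s ≥ s₀` reads `v`
only at times `T − e^{−s} ∈ [T − e^{−s₀}, T)`; the producer chooses `s₀ ≥ −log T`, the consumer (stub 1)
only uses late `s`, and its witnesses are required to have `t ≥ 0` — no stub speaks about junk slices of `v`;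
`ε ≥ 0` is forced by the shadowing clause, and `0 < T` is a hypothesis of stub 1 (without it the stub would be
false: `T < 0`, `v := u(· − T)`).
-/

noncomputable section

open Set Filter Topology Function MeasureTheory
open Literature.Analysis.FluidPDE

namespace Summit.NavierStokesRegularity.NavierStokesRegularity.Cruxes.DssTruncationBridge.Birth

set_option linter.unusedVariables false
set_option linter.dupNamespace false

local notation "E3" => EuclideanSpace ℝ (Fin 3)

/-- **stub 0 — `stub_smoothProfile_of_notLiouville` (M/L, true; KNSS §4 regularity of the representative).**
Failure of Tsai's Type-I (rotated) `λ`-DSS Liouville wall (the crux's hypothesis, verbatim) yields a Type-I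
rotated-DSS ancient profile with a jointly smooth representative, `IsTypeIDSSProfile c R u` (accepted,
`Literature.Analysis.FluidPDE.HyperbolicDSSOrbit`; the hypothesis shape of crux #4 `GaussianFloquetTheory`).
Proof route: `push_neg`; plain DSS = rotated DSS with `R = 1` (`rotatedTypeIDSSLiouville_refl_iff`,
`isRotatedDSS_refl_iff`); the Type-I bound `‖u(t,x)‖ ≤ C₀/(‖x‖ + √−t)` makes `u` bounded on every window
`t < −δ`, so the continuous representative is smooth (KNSS 2009 §2–4, in-tree `KNSS2009_mild_regularity_holds`
+ `exists_stronglyMeasurable_modification`); define it to be `0` for `t ≥ 0`; it is again rotated `c`-DSS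
(a.e. ⇒ everywhere by continuity; the identity is trivial on `t ≥ 0`), Type I everywhere, ancient mild
(integral identities), measurable, and not a.e. trivial. Sources: KNSS2009 §4, BradshawTsai2017CPDE §5. -/
theorem stub_smoothProfile_of_notLiouville :
    (¬ ∀ c : ℝ, TypeIDSSLiouville c ∧ ∀ R : E3 ≃ₗᵢ[ℝ] E3, RotatedTypeIDSSLiouville c R) →
      ∃ (c : ℝ) (R : E3 ≃ₗᵢ[ℝ] E3) (u : ℝ → E3 → E3), IsTypeIDSSProfile c R u := by
  sorry

/-- **stub 1 — `stub_singularPoint_of_orbitShadowing` (S/M, true; scaling + twisted periodicity only).**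
Let `u` be rotated `c`-DSS with `1 < c` (so `U = lerayOrbit u` satisfies
`U(s + 2 log c, y) = R⁻¹ U(s, R y)`, accepted `IsRotatedDSS.lerayOrbit_add_period`), let `0 < T`, and let the
similarity orbit of a field `v` about `(0, T)`, `V = lerayOrbit (fun τ x => v (τ + T) x)`, shadow `U` in sup
norm for all `s ≥ s₀` up to an error `ε` which the profile orbit exceeds somewhere (`ε < ‖U(s₁, y₁)‖`). Then
`v` is unbounded, at nonnegative times, on every backward parabolic cylinder `Q_r(T, 0)`: the amplitude
`a = ‖U(s₁, y₁)‖` recurs at `(s₁ + 2k log c, R^{-k} y₁)` (same `‖y‖`), where `‖V‖ ≥ a − ε > 0`, i.e.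
`‖v(T − e^{−s}, e^{−s/2} R^{-k} y₁)‖ ≥ (a − ε) e^{s/2} → ∞` as `k → ∞`, and these physical points eventually
lie in `Q_r(T, 0)` with `t = T − e^{−s} ≥ 0`. Needs neither mildness nor the Type-I bound. -/
theorem stub_singularPoint_of_orbitShadowing :
    ∀ (c : ℝ) (R : E3 ≃ₗᵢ[ℝ] E3) (u v : ℝ → E3 → E3) (T s₀ ε : ℝ),
      1 < c → IsRotatedDSS c R u → 0 < T →
      (∃ (s : ℝ) (y : E3), ε < ‖lerayOrbit u s y‖) →
      (∀ s : ℝ, s₀ ≤ s → ∀ y : E3,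
          ‖lerayOrbit (fun τ x => v (τ + T) x) s y - lerayOrbit u s y‖ ≤ ε) →
      ∀ r : ℝ, 0 < r → ∀ M : ℝ,
        ∃ z ∈ parabolicCylinder r ((T : ℝ), (0 : E3)), 0 ≤ z.1 ∧ M < ‖v z.1 z.2‖ := by
  sorry

/-- **stub 2 — `stub_orbitShadowing_of_profile` (XL, OPEN; the heart = far-field slaving).**
For every Type-I rotated-DSS ancient profile `u` (`IsTypeIDSSProfile c R u`: `ν = 1`, `1 < c`, smooth on
`t < 0`) there are `T > 0` and a classical solution `(v, p)` of the unforced Navier–Stokes system (`ν = 1`) on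
`[0, T) × ℝ³`, Leray–Hopf on `[0, T)` from its own RAPIDLY DECAYING datum `v 0`, whose similarity orbit about
`(0, T)` shadows the profile orbit in sup norm at all late similarity times up to an error below the
profile's amplitude: `∃ s₀ ε, (∃ s y, ε < ‖U(s, y)‖) ∧ ∀ s ≥ s₀, ∀ y, ‖V(s, y) − U(s, y)‖ ≤ ε`
(`U = lerayOrbit u`, `V = lerayOrbit (v(· + T))`). Intended proof (route DssFarFieldSlaving, card
dss-far-field-slaving): datum = Bogovskiĭ-corrected Schwartz truncation `χ_ρ u(·, −T)` plus finitely many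
compactly supported solenoidal bumps; in similarity variables the perturbation `W = V − U` solves the equation
linearised at the `2 log c`-periodic orbit plus quadratic terms; COMPACT monodromy on `L²_σ(e^{−|y|²/4})`
(crux #4 `GaussianFloquetTheory`) ⇒ finite-dimensional centre-unstable space ⇒ finite-codimension strong-stable
set (Lyapunov–Perron, Henry 1981 Ch. 7–8), reached by tuning the bump coefficients; the far field is slaved
(outward drift `½ y·∇`, far-field pressure `≲ C₀²/L²`, `L = ρ e^{s/2}`) and controlled in `L^∞_{1+|y|}`
uniformly in `s`, which gives the GLOBAL-in-`y` sup bound (core: stable-set smallness; `|y| ≥ ϱ`: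
`K/(1 + ϱ)`; physical far field: `e^{−s/2} × bounded`). Why it might fail: without hyperbolicity the monodromy
may fail to be compact / carry spectrum accumulating at the unit circle (essential spectrum from the sup-norm
half of the bootstrap), and `P_σ`, Biot–Savart are undefined on `L²(γ)` verbatim (route file, crux #2/#4
why-lines). Sources: JiaSverak2015 §1–2, JiaSverak2014, BradshawTsai2017CPDE §5, AlbrittonBarker2019 Thm 1.1 /
Rem 4.3, ChaeWolf2017RemovingDSS §4, Henry1981, GallayWayne2005, MerleZaag1997, arXiv:1605.07337. -/
theorem stub_orbitShadowing_of_profile :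
    ∀ (c : ℝ) (R : E3 ≃ₗᵢ[ℝ] E3) (u : ℝ → E3 → E3), IsTypeIDSSProfile c R u →
      ∃ T : ℝ, 0 < T ∧ ∃ (v : ℝ → E3 → E3) (p : ℝ → E3 → ℝ),
        IsClassicalNSSolutionOn (Set.Ico 0 T) 1 0 v p ∧ IsLerayHopfOn T 1 0 (v 0) v ∧
        HasRapidSpatialDecay (v 0) ∧
        ∃ s₀ ε : ℝ, (∃ (s : ℝ) (y : E3), ε < ‖lerayOrbit u s y‖) ∧
          ∀ s : ℝ, s₀ ≤ s → ∀ y : E3,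
            ‖lerayOrbit (fun τ x => v (τ + T) x) s y - lerayOrbit u s y‖ ≤ ε := by
  sorry

/-- **Continuation lemma (PROVED; assembly glue).** If the velocity `v` is unbounded at nonnegative times on
the backward parabolic cylinder `Q_1(T, x₀)`, then `v` admits no classical extension past `T`: an extension
`(u', p')`, classical on `[0, T')` with `T' > T`, is jointly continuous on `[0, T') × ℝ³ ⊇ [0, T] × B̄_1(x₀)`
(compact), hence bounded there, and agrees with `v` on `[0, T)`. The velocity twin of the accepted
`VorticityBlowsUpOnAt.not_hasSmoothExtensionPast` (Beale–Kato–Majda 1984 §1, elementary half). -/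
theorem not_hasSmoothExtensionPast_of_singularPoint {ν T : ℝ} {v : ℝ → E3 → E3} {x₀ : E3}
    (h : ∀ M : ℝ, ∃ z ∈ parabolicCylinder 1 ((T : ℝ), x₀), 0 ≤ z.1 ∧ M < ‖v z.1 z.2‖) :
    ¬ HasSmoothExtensionPast ν 0 v T := by
  rintro ⟨T', hTT', u', p', hcl, hagree⟩
  have hcont : ContinuousOn (uncurry u') (Ico 0 T' ×ˢ (univ : Set E3)) :=
    ContDiffOn.continuousOn hcl.smooth_velocity
  have hsub : Icc 0 T ×ˢ Metric.closedBall x₀ 1 ⊆ Ico 0 T' ×ˢ (univ : Set E3) :=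
    prod_mono (Icc_subset_Ico_right hTT') (subset_univ _)
  obtain ⟨M, hM⟩ :=
    (isCompact_Icc.prod (isCompact_closedBall x₀ (1 : ℝ))).exists_bound_of_continuousOn (hcont.mono hsub)
  obtain ⟨z, hz, hz0, hzM⟩ := h M
  simp only [mem_parabolicCylinder] at hz
  obtain ⟨⟨-, hzT⟩, hzx⟩ := hz
  have hK : z ∈ Icc 0 T ×ˢ Metric.closedBall x₀ 1 :=
    ⟨⟨hz0, hzT.le⟩, Metric.mem_closedBall.2 hzx.le⟩
  have hle : ‖u' z.1 z.2‖ ≤ M := hM z hK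
  rw [hagree z.1 ⟨hz0, hzT⟩] at hle
  exact absurd hzM (not_lt.2 hle)

/-- **Birth composition (the skeleton theorem).** The crux BY NAME from the three registered stubs, used by
name: `ν = 1`; the profile `(c, R, u)` from stub 0; the lifespan `T`, the solution `(v, p)` and the shadowing
data `(s₀, ε)` from the heart; the singular point `(T, 0)` from stub 1; maximality from the proved
continuation lemma. -/
theorem DssTruncationBridge_of : Theses.DssFarFieldSlaving.DssTruncationBridge := by
  have h0 := stub_smoothProfile_of_notLiouville
  have h1 := stub_singularPoint_of_orbitShadowing
  have h2 := stub_orbitShadowing_of_profile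
  intro hneg
  obtain ⟨c, R, u, hu⟩ := h0 hneg
  obtain ⟨T, hT, v, p, hcl, hLH, hdec, s₀, ε, hgap, hshadow⟩ := h2 c R u hu
  have hsing := h1 c R u v T s₀ ε hu.one_lt hu.isRotatedDSS hT hgap hshadow
  refine ⟨1, one_pos, T, hT, v, p, ⟨hcl, ?_⟩, hLH, hdec⟩
  exact not_hasSmoothExtensionPast_of_singularPoint (fun M => hsing 1 one_pos M)

end Summit.NavierStokesRegularity.NavierStokesRegularity.Cruxes.DssTruncationBridge.Birth

end
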